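import Mathlib
import Summits.Ventures.FusionMHD.Models.TearingFRS1Sigma21
import Literature.MathematicalPhysics.MHD.ScrewPinchWallFactor
import Literature.Computation.Certificates.LinearODETaylorChain
import HarnessLib

/-!
# F3.r4 instance «RwmFRS1»: the external `(3,1)` kink / RESISTIVE WALL MODE of the FRS1 screw pinch — MODEL, Newcomb's
# `f`, `g` in closed form, the marginal equation in certificate form, and the boundary form of `δW` (Freidberg (11.148))

LADDER-GRIDFUSION rung F3 (resistive / extended-MHD margins), row F3.r4 of `models/F3-SCOPING.md` (§2 R5 «cylindrical
RWM, diffuse profile, no rotation: sign of `γ` and the rate `γτ_w = −δW_∞/δW_b`»; writer gridfusion-model-6, g6).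

MODEL M_RWM (MODELLED column; every hypothesis explicit): the cell's OWN FRS1 screw pinch — by NAME the equilibrium
`TearingFRS1.Sigma.dyn` of row #54 (sos-6, `Models/TearingFRS1Sigma21`): straight circular cylinder of periodicity length
`2πR₀`, `μ₀ = 1`, `B_z ≡ 1`, `p ≡ 0` (zero β), `B_θ(r) = r/(7(1+r²))` = model-6's printed ν = 1 peaked profile
(`TearingFRS1.profile`, `q(r) = (7/5)(1 + r²)` of HamEtAl2013 §4), plasma radius `a = 1`, the DECLARED aspect-ratio
choice `R₀ = 5a` (not printed; as in #54) so that the toroidal mode number `n = 1` is the axial wavenumber `k = −n/R₀ = −1/5`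
— CONTINUED (this row) by a VACUUM region `a < r < b` and a thin resistive wall at `r = b` [cite: Freidberg2014, §11.5.6].
CLASS C = the external helical mode `(m, n) = (3, 1)`: `q_a = 14/5 ∈ (2, 3)`, so `F = k·B = (8 − 7r²)/(35(1+r²))` has NO
zero in the plasma (`q = 3` only at `r² = 8/7 > a²`): Newcomb's minimising equation `(fξ′)′ = gξ`
[cite: Freidberg2014, §11.5.1 eq. (11.97), §11.5.3 eq. (11.110)] is regular on `(0, a]` apart from the axis.

THIS FILE (no numerics): `P` (the profile by name) and `kk = −1/5`; the closed forms of `F`, `F†`, `k₀²`, `f`, `f′`, `g`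
for `(m,k) = (3, −1/5)` (`kDotB_eq` … `newcombG_eq`; `g = r(8−7r²)G(r²)/(1225(1+r²)²(r²+225)²)` with
`G(s) = (8−7s)(s+200)(s+225) − 50s(22+7s) = 360000 − 312700s − 3317s² − 7s³ > 0` on `[0, 8/7]`), the signs `f > 0`,
`g > 0` on `(0, a]`, `F ≠ 0`; the marginal equation as `P₂ξ″ + P₁ξ′ + P₀ξ = 0` with integer polynomial coefficients
(`rwmEq3 : LinearODE.Equation`, the vocabulary of certnum-lean-3's kernel Taylor chains) and the BRIDGE
`newcomb_of_isSolOn` to the form `HasDerivAt (f·ξ′) (g ξ)` used by lit-4's PROVED external-mode test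
`ScrewPinch.Profile.newcombExternalModes_iff` [cite: Freidberg2014, §11.5.3 eq. (11.118)]; the regularity hypotheses of
that test for `P`; and the BOUNDARY FORM of the reference energies at `a = 1`
[cite: Freidberg2014, §11.5.6 eq. (11.148)–(11.149)]: `F_a = 1/70`, `F†_a = −29/70`, `k₀²(a) = 226/25`, hence
`δŴ(Λ)/ξ_a² = (L − 29)/44296 + Λ/14700` with `L = aξ′(a)/ξ(a)` (`boundaryForm`, `boundaryForm_eq`). Companions:
`RwmFRS1Axis*` (the axis-regular solution as a Frobenius series), `RwmFRS1Chain` (kernel Taylor chain `1/4 → 1`),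
`RwmFRS1Solution` (`L` two-sided), `RwmFRS1Energy` (the four sentences: no-wall instability, ideal-wall window, critical
wall, thin-wall RWM rate). Nothing here is a statement about a device. [instance data]
-/

noncomputable section

open Set Polynomial Literature.MathematicalPhysics.MHD Literature.Computation.Certificates
  Literature.Computation.Certificates.LinearODE

namespace Summit.Ventures.FusionMHD.Models

namespace RwmFRS1

/-! ### The model: FRS1 screw pinch (by name) and the `(3,1)` mode -/

/-- MODEL M_RWM's plasma equilibrium = row #54's `TearingFRS1.Sigma.dyn` seen as a `ScrewPinch.Profile`
(`μ₀ = 1`, `B_θ = r/(7(1+r²))`, `B_z ≡ 1`, `p ≡ 0`). [instance data] -/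
def P : ScrewPinch.Profile := TearingFRS1.Sigma.dyn.toProfile

/-- The axial wavenumber of the `n = 1` mode at the declared `R₀ = 5a`: `k = −n/R₀ = −1/5`. [instance data] -/
def kk : ℝ := -1 / 5

/-- `μ₀ = 1`. [instance data] -/
@[simp] theorem P_μ₀ : P.μ₀ = 1 := rfl

/-- `B_z ≡ 1`. [instance data] -/
@[simp] theorem P_Bz (r : ℝ) : P.Bz r = 1 := rfl

/-- `p ≡ 0`. [instance data] -/
@[simp] theorem P_p (r : ℝ) : P.p r = 0 := rfl

/-- `B_θ(r) = r/(7(1+r²))` (sos-6's dictionary `dyn_Bθ`). [instance data] -/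
theorem P_Bθ (r : ℝ) : P.Bθ r = r / (7 * (1 + r ^ 2)) := by
  show TearingFRS1.Sigma.dyn.Bθ r = _
  rw [TearingFRS1.Sigma.dyn_Bθ, TearingFRS1.Sigma.u]
  ring

/-- `B_θ(0) = 0` (regular axis). [instance data] -/
theorem P_Bθ_zero : P.Bθ 0 = 0 := by rw [P_Bθ]; simp

/-- `B_θ` is smooth on `ℝ`. [instance data] -/
theorem contDiff_Bθ : ContDiff ℝ 1 P.Bθ := by
  have e : P.Bθ = fun r : ℝ => r / (7 * (1 + r ^ 2)) := funext P_Bθ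
  rw [e]
  refine ContDiff.div (by fun_prop) (by fun_prop) fun r => by positivity

/-- The regularity hypotheses of Newcomb's external-mode test for this profile on `(−b, b)`, any `b`. [instance data] -/
theorem profile_regular (b : ℝ) :
    ContDiffOn ℝ 1 P.Bθ (Ioo (-b) b) ∧ ContDiffOn ℝ 1 P.Bz (Ioo (-b) b) ∧ ContDiffOn ℝ 1 P.p (Ioo (-b) b) ∧
      P.Bθ 0 = 0 :=
  ⟨contDiff_Bθ.contDiffOn, by
    rw [show P.Bz = fun _ => (1 : ℝ) from funext P_Bz]; exact contDiffOn_const, by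
    rw [show P.p = fun _ => (0 : ℝ) from funext P_p]; exact contDiffOn_const, P_Bθ_zero⟩

/-! ### Closed forms of `F`, `F†`, `k₀²`, `f`, `g` for `(m, k) = (3, −1/5)` -/

/-- `F = kB_z + mB_θ/r = (8 − 7r²)/(35(1+r²))` (`r ≠ 0`). [cite: Freidberg2014, §11.5.1 eq. (11.90)] -/
theorem kDotB_eq {r : ℝ} (hr : r ≠ 0) : P.kDotB 3 kk r = (8 - 7 * r ^ 2) / (35 * (1 + r ^ 2)) := by
  have h1 : (0 : ℝ) < 1 + r ^ 2 := by positivity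
  rw [ScrewPinch.Profile.kDotB, P_Bθ, P_Bz, kk]
  field_simp
  ring

/-- `F† = kB_z − mB_θ/r = −(22 + 7r²)/(35(1+r²))` (`r ≠ 0`). [cite: Freidberg2014, §11.5.1 eq. (11.89)] -/
theorem kDotBDagger_eq {r : ℝ} (hr : r ≠ 0) : P.kDotBDagger 3 kk r = -(22 + 7 * r ^ 2) / (35 * (1 + r ^ 2)) := by
  have h1 : (0 : ℝ) < 1 + r ^ 2 := by positivity
  rw [ScrewPinch.Profile.kDotBDagger, P_Bθ, P_Bz, kk]
  field_simp
  ring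

/-- `k₀² = k² + m²/r² = (r² + 225)/(25r²)` (`r ≠ 0`). [cite: Freidberg2014, §11.5.1 eq. (11.85)] -/
theorem k0Sq_eq {r : ℝ} (hr : r ≠ 0) : ScrewPinch.Profile.k0Sq 3 kk r = (r ^ 2 + 225) / (25 * r ^ 2) := by
  rw [ScrewPinch.Profile.k0Sq, kk]
  field_simp
  ring

/-- Newcomb's `f = rF²/k₀² = r³(8−7r²)²/(49(1+r²)²(r²+225))` (`r ≠ 0`). [cite: Freidberg2014, §11.5.1 eq. (11.90)] -/
theorem newcombF_eq {r : ℝ} (hr : r ≠ 0) :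
    P.newcombF 3 kk r = r ^ 3 * (8 - 7 * r ^ 2) ^ 2 / (49 * (1 + r ^ 2) ^ 2 * (r ^ 2 + 225)) := by
  have h1 : (0 : ℝ) < 1 + r ^ 2 := by positivity
  have h2 : (0 : ℝ) < r ^ 2 + 225 := by positivity
  rw [ScrewPinch.Profile.newcombF, kDotB_eq hr, k0Sq_eq hr]
  field_simp
  ring

/-- The cubic `G(s) = (8−7s)(s+200)(s+225) − 50s(22+7s) = 360000 − 312700s − 3317s² − 7s³` of the numerator of `g`.
[instance data] -/
def Gpoly (s : ℝ) : ℝ := 360000 - 312700 * s - 3317 * s ^ 2 - 7 * s ^ 3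

/-- `G(s) = (8−7s)(s+200)(s+225) − 50s(22+7s)`. [instance data] -/
theorem Gpoly_eq (s : ℝ) : Gpoly s = (8 - 7 * s) * (s + 200) * (s + 225) - 50 * s * (22 + 7 * s) := by
  unfold Gpoly; ring

/-- `G > 0` on `[0, 1]` (`G(s) ≥ 360000 − 312700 − 3317 − 7 = 43976` there; `G` changes sign on `(1, 8/7)`, outside the
plasma). [instance data] -/
theorem Gpoly_pos {s : ℝ} (h0 : 0 ≤ s) (h1 : s ≤ 1) : 0 < Gpoly s := by
  unfold Gpoly
  have h2 : s ^ 2 ≤ 1 := by nlinarith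
  have h3 : s ^ 3 ≤ 1 := by nlinarith
  nlinarith

/-- Newcomb's `g` (11.90) with `p′ = 0`: `g = r(8−7r²)G(r²)/(1225(1+r²)²(r²+225)²)` (`r ≠ 0`).
[cite: Freidberg2014, §11.5.1 eq. (11.90)] -/
theorem newcombG_eq {r : ℝ} (hr : r ≠ 0) :
    P.newcombG 3 kk r = r * (8 - 7 * r ^ 2) * Gpoly (r ^ 2) / (1225 * (1 + r ^ 2) ^ 2 * (r ^ 2 + 225) ^ 2) := by
  have h1 : (0 : ℝ) < 1 + r ^ 2 := by positivity
  have h2 : (0 : ℝ) < r ^ 2 + 225 := by positivity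
  have hp : deriv P.p r = 0 := by
    rw [show P.p = fun _ => (0 : ℝ) from funext P_p, deriv_const]
  rw [ScrewPinch.Profile.newcombG, hp, kDotB_eq hr, kDotBDagger_eq hr, k0Sq_eq hr, Gpoly, kk, P_μ₀]
  field_simp
  ring

/-- `F ≠ 0` on `0 < r`, `r² < 8/7` (no resonant surface of the `(3,1)` mode in the plasma: `q < 3`). [instance data] -/
theorem kDotB_ne_zero {r : ℝ} (hr : 0 < r) (h : r ^ 2 < 8 / 7) : P.kDotB 3 kk r ≠ 0 := by
  rw [kDotB_eq hr.ne']
  have h1 : (0 : ℝ) < 1 + r ^ 2 := by positivity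
  exact div_ne_zero (by nlinarith) (by positivity)

/-- `F > 0` there (sign convention `k = −1/5 < 0`, `m B_θ/r > |k|`). [instance data] -/
theorem kDotB_pos {r : ℝ} (hr : 0 < r) (h : r ^ 2 < 8 / 7) : 0 < P.kDotB 3 kk r := by
  rw [kDotB_eq hr.ne']
  have h1 : (0 : ℝ) < 1 + r ^ 2 := by positivity
  exact div_pos (by nlinarith) (by positivity)

/-- `f > 0` on `0 < r`, `r² < 8/7`. [instance data] -/
theorem newcombF_pos {r : ℝ} (hr : 0 < r) (h : r ^ 2 < 8 / 7) : 0 < P.newcombF 3 kk r := by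
  rw [newcombF_eq hr.ne']
  have h3 : (0 : ℝ) < (8 - 7 * r ^ 2) ^ 2 := by nlinarith
  positivity

/-- `g > 0` on the plasma `0 < r ≤ 1` (= a). [instance data] -/
theorem newcombG_pos {r : ℝ} (hr : 0 < r) (h : r ≤ 1) : 0 < P.newcombG 3 kk r := by
  rw [newcombG_eq hr.ne']
  have hr2 : r ^ 2 ≤ 1 := by nlinarith
  have hG := Gpoly_pos (sq_nonneg r) hr2
  have h8 : (0 : ℝ) < 8 - 7 * r ^ 2 := by nlinarith
  positivity

/-! ### The marginal equation in certificate form and the bridge to Newcomb's `(fξ′)′ = gξ` -/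

/-- Newcomb's marginal equation `(fξ′)′ − gξ = 0` of MODEL M_RWM, mode `(3,1)`, cleared of denominators:
`P₂ξ″ + P₁ξ′ + P₀ξ = 0` with `P₂ = 25r²(8−7r²)(1+r²)(r²+225)`, `P₁ = 25r(5400 − 12817r² − 4784r⁴ − 7r⁶)`,
`P₀ = −(1+r²)G(r²)` (coefficient lists, low degree first; exact). [instance data] -/
def rwmEq3 : Equation :=
  ⟨[0, 0, 45000, 0, 5825, 0, -39350, 0, -175], [0, 135000, 0, -320425, 0, -119600, 0, -175],
    [-360000, 0, -47300, 0, 316017, 0, 3324, 0, 7]⟩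

/-- `P₂(r) = 25r²(8−7r²)(1+r²)(r²+225)`. [instance data] -/
theorem eval_P2 (r : ℝ) :
    (toPolyR rwmEq3.P2).eval r = 25 * r ^ 2 * (8 - 7 * r ^ 2) * (1 + r ^ 2) * (r ^ 2 + 225) := by
  simp [rwmEq3, toPolyR, Finset.sum_range_succ]
  ring

/-- `P₁(r) = 25r(5400 − 12817r² − 4784r⁴ − 7r⁶)`. [instance data] -/
theorem eval_P1 (r : ℝ) :
    (toPolyR rwmEq3.P1).eval r = 25 * r * (5400 - 12817 * r ^ 2 - 4784 * r ^ 4 - 7 * r ^ 6) := by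
  simp [rwmEq3, toPolyR, Finset.sum_range_succ]
  ring

/-- `P₀(r) = −(1+r²)G(r²)`. [instance data] -/
theorem eval_P0 (r : ℝ) : (toPolyR rwmEq3.P0).eval r = -(1 + r ^ 2) * Gpoly (r ^ 2) := by
  rw [Gpoly]
  simp [rwmEq3, toPolyR, Finset.sum_range_succ]
  try ring

/-- `P₂ ≠ 0` on `0 < r`, `r² < 8/7`. [instance data] -/
theorem eval_P2_ne_zero {r : ℝ} (hr : 0 < r) (h : r ^ 2 < 8 / 7) : (toPolyR rwmEq3.P2).eval r ≠ 0 := by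
  rw [eval_P2]
  have h8 : (0 : ℝ) < 8 - 7 * r ^ 2 := by linarith
  positivity

/-- The solved-form coefficient `𝔭 = −P₁/P₂`. [instance data] -/
theorem pH_eq {r : ℝ} (hr : 0 < r) (h : r ^ 2 < 8 / 7) :
    rwmEq3.pH r = -(5400 - 12817 * r ^ 2 - 4784 * r ^ 4 - 7 * r ^ 6) /
      (r * (8 - 7 * r ^ 2) * (1 + r ^ 2) * (r ^ 2 + 225)) := by
  have h8 : (8 - 7 * r ^ 2 : ℝ) ≠ 0 := by nlinarith
  have h1 : (0 : ℝ) < 1 + r ^ 2 := by positivity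
  have h2 : (0 : ℝ) < r ^ 2 + 225 := by positivity
  have hr0 := hr.ne'
  rw [Equation.pH, eval_P1, eval_P2]
  field_simp

/-- The solved-form coefficient `𝔮 = −P₀/P₂ = g/f`. [instance data] -/
theorem qH_eq (r : ℝ) :
    rwmEq3.qH r = (1 + r ^ 2) * Gpoly (r ^ 2) / (25 * r ^ 2 * (8 - 7 * r ^ 2) * (1 + r ^ 2) * (r ^ 2 + 225)) := by
  rw [Equation.qH, eval_P0, eval_P2]
  ring

/-- The derivative of `f`: `f′ = r²(8−7r²)(5400 − 12817r² − 4784r⁴ − 7r⁶)/(49(1+r²)³(r²+225)²)` on `0 < r`, `r² < 8/7`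
(so `P₁/P₂ = f′/f`). [instance data] -/
theorem hasDerivAt_newcombF {r : ℝ} (hr : 0 < r) :
    HasDerivAt (P.newcombF 3 kk)
      (r ^ 2 * (8 - 7 * r ^ 2) * (5400 - 12817 * r ^ 2 - 4784 * r ^ 4 - 7 * r ^ 6) /
        (49 * (1 + r ^ 2) ^ 3 * (r ^ 2 + 225) ^ 2)) r := by
  have h1 : (0 : ℝ) < 1 + r ^ 2 := by positivity
  have h2 : (0 : ℝ) < r ^ 2 + 225 := by positivity
  -- `f` agrees with the closed form near `r` (an open neighbourhood avoiding `0`)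
  have hev : (fun s => s ^ 3 * (8 - 7 * s ^ 2) ^ 2 / (49 * (1 + s ^ 2) ^ 2 * (s ^ 2 + 225))) =ᶠ[nhds r]
      P.newcombF 3 kk := by
    filter_upwards [isOpen_Ioi.mem_nhds hr] with s hs
    rw [newcombF_eq (ne_of_gt hs)]
  have hd : HasDerivAt (fun s : ℝ => s ^ 3 * (8 - 7 * s ^ 2) ^ 2 / (49 * (1 + s ^ 2) ^ 2 * (s ^ 2 + 225)))
      (((3 * r ^ 2 * (8 - 7 * r ^ 2) ^ 2 + r ^ 3 * (2 * (8 - 7 * r ^ 2) * (-(7 * (2 * r))))) *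
          (49 * (1 + r ^ 2) ^ 2 * (r ^ 2 + 225)) -
        r ^ 3 * (8 - 7 * r ^ 2) ^ 2 * (49 * (2 * (1 + r ^ 2) * (2 * r)) * (r ^ 2 + 225) + 49 * (1 + r ^ 2) ^ 2 * (2 * r))) /
        (49 * (1 + r ^ 2) ^ 2 * (r ^ 2 + 225)) ^ 2) r := by
    have hnum : HasDerivAt (fun s : ℝ => s ^ 3 * (8 - 7 * s ^ 2) ^ 2)
        (3 * r ^ 2 * (8 - 7 * r ^ 2) ^ 2 + r ^ 3 * (2 * (8 - 7 * r ^ 2) * (-(7 * (2 * r))))) r := by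
      have ha := hasDerivAt_pow 3 r
      have hb : HasDerivAt (fun s : ℝ => 8 - 7 * s ^ 2) (-(7 * (2 * r))) r := by
        simpa using ((hasDerivAt_pow 2 r).const_mul 7).const_sub 8
      have hb2 := hb.pow 2
      exact (ha.mul hb2).congr_deriv (by simp only [Pi.pow_apply]; push_cast; ring)
    have hden : HasDerivAt (fun s : ℝ => 49 * (1 + s ^ 2) ^ 2 * (s ^ 2 + 225))
        (49 * (2 * (1 + r ^ 2) * (2 * r)) * (r ^ 2 + 225) + 49 * (1 + r ^ 2) ^ 2 * (2 * r)) r := by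
      have hc : HasDerivAt (fun s : ℝ => 1 + s ^ 2) (2 * r) r := by
        simpa using (hasDerivAt_pow 2 r).const_add 1
      have hc2 := (hc.pow 2).const_mul 49
      have he : HasDerivAt (fun s : ℝ => s ^ 2 + 225) (2 * r) r := by
        simpa using (hasDerivAt_pow 2 r).add_const 225
      exact (hc2.mul he).congr_deriv (by simp only [Pi.pow_apply]; push_cast; ring)
    exact hnum.div hden (by positivity)
  refine (hd.congr_of_eventuallyEq hev.symm).congr_deriv ?_
  field_simp
  ring

/-- **BRIDGE.** A pair `(ξ, ξ′)` solving `rwmEq3` in the certificate sense on an OPEN set `s ⊆ {0 < r, r² < 8/7}`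
(`ξ′ = dξ/dr`, `ξ″ = 𝔭ξ′ + 𝔮ξ`) satisfies Newcomb's marginal equation in lit-4's form there:
`d/dr (f · deriv ξ) = g ξ`. [cite: Freidberg2014, §11.5.3 eq. (11.110)] -/
theorem newcomb_of_isSolOn {ξ ξ' : ℝ → ℝ} {s : Set ℝ} (hs : IsOpen s) (hsub : ∀ r ∈ s, 0 < r ∧ r ^ 2 < 8 / 7)
    (hsol : rwmEq3.IsSolOn ξ ξ' s) {r : ℝ} (hr : r ∈ s) :
    HasDerivAt (fun x => P.newcombF 3 kk x * deriv ξ x) (P.newcombG 3 kk r * ξ r) r := by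
  obtain ⟨hr0, hr8⟩ := hsub r hr
  obtain ⟨h1, h2⟩ := hsol r hr
  -- `deriv ξ = ξ′` near `r`
  have hev : ξ' =ᶠ[nhds r] deriv ξ := by
    filter_upwards [hs.mem_nhds hr] with x hx
    exact ((hsol x hx).1.deriv).symm
  have h2' : HasDerivAt (deriv ξ) (rwmEq3.pH r * ξ' r + rwmEq3.qH r * ξ r) r := h2.congr_of_eventuallyEq hev.symm
  have hf := hasDerivAt_newcombF hr0
  have hprod := hf.mul h2'
  refine hprod.congr_deriv ?_
  rw [h1.deriv, newcombF_eq hr0.ne', newcombG_eq hr0.ne', pH_eq hr0 hr8, qH_eq]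
  have h8 : (8 - 7 * r ^ 2 : ℝ) ≠ 0 := by nlinarith
  have h1' : (0 : ℝ) < 1 + r ^ 2 := by positivity
  have h2'' : (0 : ℝ) < r ^ 2 + 225 := by positivity
  have hr0' := hr0.ne'
  field_simp
  ring

/-! ### The boundary form of the reference energies at `a = 1` (Freidberg (11.148)–(11.149)) -/

/-- Edge values: `F_a = 1/70`, `F†_a = −29/70`, `k₀²(a) = 226/25`, `f(a) = 1/44296`. [instance data] -/
theorem edge_values : P.kDotB 3 kk 1 = 1 / 70 ∧ P.kDotBDagger 3 kk 1 = -29 / 70 ∧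
    ScrewPinch.Profile.k0Sq 3 kk 1 = 226 / 25 ∧ P.newcombF 3 kk 1 = 1 / 44296 := by
  refine ⟨?_, ?_, ?_, ?_⟩
  · rw [kDotB_eq one_ne_zero]; norm_num
  · rw [kDotBDagger_eq one_ne_zero]; norm_num
  · rw [k0Sq_eq one_ne_zero]; norm_num
  · rw [newcombF_eq one_ne_zero]; norm_num

/-- THE BOUNDARY FORM of the reference energies per `ξ(a)²`, as a function of the logarithmic derivative
`L = aξ′(a)/ξ(a)` of the marginal solution and the wall factor `Λ`:
`δŴ(L, Λ) := (F²/k₀²) L + FF†/k₀² + a²F²Λ/m` at `a = 1`, `m = 3`. [cite: Freidberg2014, §11.5.6 eq. (11.148)–(11.149)] -/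
def boundaryForm (L Λ : ℝ) : ℝ :=
  P.kDotB 3 kk 1 ^ 2 / ScrewPinch.Profile.k0Sq 3 kk 1 * L +
    P.kDotB 3 kk 1 * P.kDotBDagger 3 kk 1 / ScrewPinch.Profile.k0Sq 3 kk 1 +
    1 ^ 2 * P.kDotB 3 kk 1 ^ 2 * Λ / 3

/-- **`δŴ(L, Λ) = (L − 29)/44296 + Λ/14700`** (exact). [instance data] -/
theorem boundaryForm_eq (L Λ : ℝ) : boundaryForm L Λ = (L - 29) / 44296 + Λ / 14700 := by
  obtain ⟨e1, e2, e3, -⟩ := edge_values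
  rw [boundaryForm, e1, e2, e3]
  ring

/-- `δŴ` is the quantity of lit-4's `newcombExternalModes_iff` (its right-hand side is `δŴ(aξ₁′(a)/ξ₁(a), Λ)·ξ₁(a)²`
at `a = 1`, `m = 3`). [cite: Freidberg2014, §11.5.3 eq. (11.118)] -/
theorem boundaryForm_mul (ξ₁ : ℝ → ℝ) (Λ : ℝ) :
    (P.kDotB 3 kk 1 ^ 2 / ScrewPinch.Profile.k0Sq 3 kk 1 * (1 * deriv ξ₁ 1 / ξ₁ 1) +
        P.kDotB 3 kk 1 * P.kDotBDagger 3 kk 1 / ScrewPinch.Profile.k0Sq 3 kk 1 +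
        1 ^ 2 * P.kDotB 3 kk 1 ^ 2 * Λ / 3) * ξ₁ 1 ^ 2 =
      boundaryForm (1 * deriv ξ₁ 1 / ξ₁ 1) Λ * ξ₁ 1 ^ 2 := by
  rw [boundaryForm]

/-- `δŴ` is strictly increasing in `Λ` (slope `F_a²/3 = 1/14700 > 0`): the wall can only help.
[cite: Freidberg2014, §11.5.6 eq. (11.150) «Clearly Λ_b > Λ_∞»] -/
theorem boundaryForm_strictMono (L : ℝ) : StrictMono (boundaryForm L) := by
  intro x y hxy
  rw [boundaryForm_eq, boundaryForm_eq]
  linarith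

/-- The critical wall factor at which `δŴ` changes sign: `Λ_crit(L) = (29 − L)·14700/44296`, i.e.
`δŴ(L, Λ) = (Λ − Λ_crit(L))/14700`. [instance data] -/
def lambdaCrit (L : ℝ) : ℝ := (29 - L) * 14700 / 44296

/-- `δŴ(L, Λ) = (Λ − Λ_crit)/14700`. [instance data] -/
theorem boundaryForm_eq_sub (L Λ : ℝ) : boundaryForm L Λ = (Λ - lambdaCrit L) / 14700 := by
  rw [boundaryForm_eq, lambdaCrit]
  ring

/-- `δŴ > 0 ⟺ Λ > Λ_crit`. [instance data] -/
theorem boundaryForm_pos_iff (L Λ : ℝ) : 0 < boundaryForm L Λ ↔ lambdaCrit L < Λ := by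
  rw [boundaryForm_eq_sub]
  constructor
  · intro h; by_contra hle; rw [not_lt] at hle
    have : (Λ - lambdaCrit L) / 14700 ≤ 0 := div_nonpos_of_nonpos_of_nonneg (by linarith) (by norm_num)
    linarith
  · intro h; exact div_pos (by linarith) (by norm_num)

/-- `δŴ < 0 ⟺ Λ < Λ_crit`. [instance data] -/
theorem boundaryForm_neg_iff (L Λ : ℝ) : boundaryForm L Λ < 0 ↔ Λ < lambdaCrit L := by
  rw [boundaryForm_eq_sub]
  constructor
  · intro h; by_contra hle; rw [not_lt] at hle
    have : 0 ≤ (Λ - lambdaCrit L) / 14700 := div_nonneg (by linarith) (by norm_num)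
    linarith
  · intro h; exact div_neg_of_neg_of_pos (by linarith) (by norm_num)

end RwmFRS1

end Summit.Ventures.FusionMHD.Models

end
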